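import Mathlib.LinearAlgebra.FreeModule.PID
import Mathlib.Algebra.EuclideanDomain.Int
import Mathlib.RingTheory.PrincipalIdealDomain
import Mathlib.LinearAlgebra.LinearIndependent.BaseChange
import Mathlib.LinearAlgebra.Matrix.ToLin
import Mathlib.Topology.Algebra.InfiniteSum.Basic
import Mathlib.Analysis.RCLike.Basic
import HarnessLib

/-!
# Integer bases of relation lattices: parametrising `{c ∈ ℤᴾ : ∑ c_p v_p = 0}` by `ℤᴺ`

Support file (pure algebra, no named fact) for the dual / monopole-gas representation of abelian
lattice gauge theories (proof programme of
`Literature.MathematicalPhysics.QuantumFieldTheory.FrohlichSpencerU1PerimeterLawD4`): after the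
duality transformation the partition functions are sums over the INTEGER CLOSED plaquette fields of a
box, `{c : P → ℤ | ∑_p c_p • ∂p = 0}` (tree: `U1DualFluxEnsemble`,
`frohlichSpencerU1PerimeterLawD4_of_closedFlux_ratio`), while Poisson summation
(`StripWeightPoisson.tsum_prodWeight_eq_tsum_ft`) wants a sum over a full integer lattice `ℤᴺ`
pushed forward by an integer matrix `M` that is injective over `ℝ` ("integer potentials in a fixed
gauge"). Instead of an explicit axial gauge we use the structure theory of finitely generated modules
over a PID: the relation module is free (Mathlib `Submodule.basisOfPid`), a `ℤ`-basis gives `M`, and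
`ℤ`-linearly independent integer vectors stay linearly independent over `ℝ`
(Mathlib `linearIndependent_algebraMap_comp_iff`).

* `exists_intBasis_of_relations` — for any family `v : P → Y` in an abelian group there are `N` and
  `M : Matrix P (Fin N) ℤ` with (i) every `Mm` a relation, (ii) every relation uniquely of the form
  `Mm`, (iii) `ker (M : ℝᴺ → ℝᴾ) = ⊥`;
* `tsum_ite_relations_eq` — `∑_{c ∈ ℤᴾ} [∑ c_p v_p = 0] f(c) = ∑_{m ∈ ℤᴺ} f(Mm)` (re-indexing, no
  summability needed).

Everything is proved; no named fact is introduced.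

## References

* J. Fröhlich, T. Spencer, Comm. Math. Phys. 83 (1982) 411–454, §2.4 (2.21)–(2.24) (the dual
  potentials `α`, `n = dα`, summed over gauge classes). [FrohlichSpencerCMP1982]
-/

noncomputable section

open Module Matrix Finset Function

namespace Literature.Algebra.EuclideanLattices

namespace IntegerKernelBasis

variable {P : Type*} [Fintype P] {Y : Type*} [AddCommGroup Y]

/-- The relation module `L_v = {c : P → ℤ | ∑_p c_p • v_p = 0}` of a family `v`. [folklore] -/
def relations (v : P → Y) : Submodule ℤ (P → ℤ) := LinearMap.ker (Fintype.linearCombination ℤ v)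

/-- Membership in the relation module. [folklore] -/
theorem mem_relations {v : P → Y} {c : P → ℤ} : c ∈ relations v ↔ ∑ p, c p • v p = 0 := by
  rw [relations, LinearMap.mem_ker, Fintype.linearCombination_apply]

/-- The matrix of a family of integer vectors, as columns: `(colMatrix b)_{pj} = (b j)_p`. [folklore] -/
def colMatrix {N : ℕ} (b : Fin N → P → ℤ) : Matrix P (Fin N) ℤ := Matrix.of fun p j => b j p

omit [Fintype P] in
/-- `colMatrix b *ᵥ m = ∑_j m_j • b_j`. [folklore] -/
theorem colMatrix_mulVec {N : ℕ} (b : Fin N → P → ℤ) (m : Fin N → ℤ) :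
    colMatrix b *ᵥ m = ∑ j, m j • b j := by
  funext p
  simp only [colMatrix, Matrix.mulVec, dotProduct, Matrix.of_apply, Finset.sum_apply, Pi.smul_apply,
    smul_eq_mul]
  exact Finset.sum_congr rfl fun j _ => mul_comm _ _

omit [Fintype P] in
/-- The same over `ℝ`: `(colMatrix b : ℝ) *ᵥ x = ∑_j x_j • (b_j : ℝᴾ)`. [folklore] -/
theorem colMatrix_map_mulVec {N : ℕ} (b : Fin N → P → ℤ) (x : Fin N → ℝ) :
    (colMatrix b).map (Int.cast : ℤ → ℝ) *ᵥ x = ∑ j, x j • (fun p => (b j p : ℝ)) := by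
  funext p
  simp only [colMatrix, Matrix.mulVec, dotProduct, Matrix.map_apply, Matrix.of_apply, Finset.sum_apply,
    Pi.smul_apply, smul_eq_mul]
  exact Finset.sum_congr rfl fun j _ => mul_comm _ _

/-- **Integer basis of a relation lattice.** For every family `v : P → Y` (`P` finite, `Y` an
abelian group) there are `N` and an integer matrix `M : P × N` such that (i) `∑_p (Mm)_p • v_p = 0`
for all `m ∈ ℤᴺ`; (ii) every integer relation `c` (`∑ c_p • v_p = 0`) is `Mm` for a unique
`m ∈ ℤᴺ`; (iii) `M` is injective as a real matrix. [folklore] -/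
theorem exists_intBasis_of_relations (v : P → Y) :
    ∃ (N : ℕ) (M : Matrix P (Fin N) ℤ),
      (∀ m : Fin N → ℤ, ∑ p, (M *ᵥ m) p • v p = 0) ∧
      (∀ c : P → ℤ, ∑ p, c p • v p = 0 → ∃! m : Fin N → ℤ, M *ᵥ m = c) ∧
      LinearMap.ker (Matrix.mulVecLin (M.map (Int.cast : ℤ → ℝ))) = ⊥ := by
  classical
  set L : Submodule ℤ (P → ℤ) := relations v with hL
  obtain ⟨N, bL⟩ := Submodule.basisOfPid (Pi.basisFun ℤ P) L
  -- the columns: the basis vectors as integer vectors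
  set b : Fin N → P → ℤ := fun j => ((bL j : L) : P → ℤ) with hb
  refine ⟨N, colMatrix b, ?_, ?_, ?_⟩
  · -- (i) every `Mm` is a relation
    intro m
    rw [← mem_relations, colMatrix_mulVec]
    exact L.sum_mem fun j _ => L.smul_mem (m j) (bL j).2
  · -- (ii) unique representation of relations
    intro c hc
    have hcL : c ∈ L := mem_relations.2 hc
    have hrepr : ∀ m : Fin N → ℤ, colMatrix b *ᵥ m = ((bL.equivFun.symm m : L) : P → ℤ) := by
      intro m
      rw [colMatrix_mulVec, Basis.equivFun_symm_apply, Submodule.coe_sum]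
      exact Finset.sum_congr rfl fun j _ => by rw [Submodule.coe_smul_of_tower]
    refine ⟨bL.equivFun ⟨c, hcL⟩, ?_, ?_⟩
    · show colMatrix b *ᵥ (bL.equivFun ⟨c, hcL⟩) = c
      rw [hrepr, LinearEquiv.symm_apply_apply]
    · intro m hm
      rw [hrepr] at hm
      have h1 : bL.equivFun.symm m = ⟨c, hcL⟩ := Subtype.ext hm
      rw [← h1, LinearEquiv.apply_symm_apply]
  · -- (iii) injectivity over `ℝ`: `ℤ`-independent integer vectors are `ℝ`-independent
    have hvZ : LinearIndependent ℤ b := by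
      have := bL.linearIndependent.map' L.subtype (Submodule.ker_subtype L)
      exact this
    have hvR : LinearIndependent ℝ (fun j => algebraMap ℤ ℝ ∘ b j) :=
      linearIndependent_algebraMap_comp_iff.2 hvZ
    rw [LinearMap.ker_eq_bot']
    intro x hx
    rw [Matrix.mulVecLin_apply, colMatrix_map_mulVec] at hx
    have hx' : ∑ j, x j • (algebraMap ℤ ℝ ∘ b j) = 0 := by
      rw [← hx]
      exact Finset.sum_congr rfl fun j _ => by rfl
    funext j
    exact Fintype.linearIndependent_iff.1 hvR x hx' j

open Classical in
/-- **Re-indexing a sum over integer relations by `ℤᴺ`**: if `M` parametrises the relations of `v`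
bijectively ((i)–(ii) of `exists_intBasis_of_relations`), then for every `f`,
`∑_{c ∈ ℤᴾ} [∑ c_p • v_p = 0] f(c) = ∑_{m ∈ ℤᴺ} f(Mm)` (unconditionally, as `tsum`s). [folklore] -/
theorem tsum_ite_relations_eq {α : Type*} [AddCommMonoid α] [TopologicalSpace α] (v : P → Y) {N : ℕ}
    (M : Matrix P (Fin N) ℤ) (hM₁ : ∀ m : Fin N → ℤ, ∑ p, (M *ᵥ m) p • v p = 0)
    (hM₂ : ∀ c : P → ℤ, ∑ p, c p • v p = 0 → ∃! m : Fin N → ℤ, M *ᵥ m = c) (f : (P → ℤ) → α) :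
    ∑' c : P → ℤ, (if ∑ p, c p • v p = 0 then f c else 0) = ∑' m : Fin N → ℤ, f (M *ᵥ m) := by
  set s : Set (P → ℤ) := {c | ∑ p, c p • v p = 0} with hs
  have h1 : (fun c : P → ℤ => if ∑ p, c p • v p = 0 then f c else 0) = s.indicator f := by
    funext c
    simp only [hs, Set.indicator_apply, Set.mem_setOf_eq]
  rw [h1, ← tsum_subtype s f]
  -- the bijection `ℤᴺ ≃ s`
  have hbij : Function.Bijective (fun m : Fin N → ℤ => (⟨M *ᵥ m, hM₁ m⟩ : s)) := by
    refine ⟨fun m m' h => ?_, fun c => ?_⟩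
    · have h' : M *ᵥ m = M *ᵥ m' := congrArg Subtype.val h
      obtain ⟨m₀, -, huniq⟩ := hM₂ (M *ᵥ m') (hM₁ m')
      exact (huniq m h').trans (huniq m' rfl).symm
    · obtain ⟨m, hm, -⟩ := hM₂ c.1 c.2
      exact ⟨m, Subtype.ext hm⟩
  rw [← (Equiv.ofBijective _ hbij).tsum_eq (fun c : s => f c)]
  rfl

end IntegerKernelBasis

end Literature.Algebra.EuclideanLattices
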